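import Summits.CriticalPhenomena.PercolationContinuityZ3.Theorems.PercNearOneGluingNoHeavyLowerTailSahiResampledMargin
import Mathlib.Tactic.Linarith
import Mathlib.Tactic.Ring
import HarnessLib

/-!
# `NoHeavyLowerTail` (crux stmt-CriticalPhenomena-4575), P2: the BLOCK-AVERAGING IDENTITY
# `E_3(f,g,h) = E_3^γ(f, E_β g, E_{αβ} h) + 2E_c[f·C] − E f·E_c[C]` and the HALF-COVARIANCE FACE of Kahn's C_3 for `|T_3| ≤ 1`

Support file of the one-cut programme (Sahi's algebraic route, seat `prim-masterthm-p2`, gen 24; memo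
`run/shared/lean/prim/prim-masterthm/FROM-prim-masterthm-p2-g24-RESAMPLED-MARGIN.md` §1b; `--supports stmt-CriticalPhenomena-4575`).  Pure proofs; no `sorry`, no definitions,
no named facts, standard axioms.

SETTING (`…SahiResampledMargin`, `…SahiSharedTwoPointIdentity`): blocks `α, β, γ` with weights `wA, wB, wC`, `f : γ → α → ℝ`, `g : γ → β → ℝ`, `h : γ → α → β → ℝ`.

* `sahiE_three_perm` — `E_3` is invariant under the cyclic permutation of its three arguments (plumbing).
* **`sahiE_three_eq_proj_add` (BLOCK-AVERAGING IDENTITY).**  If `f c a = φ c` ignores the block `α` (for cubes: `γ ⊇ supp f`) then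
  `E_3(f,g,h) = E_3^γ(φ, G_C, H̄) + 2E_c[φ·C] − (E_c φ)(E_c C)`,  `G_C = E_b g`, `H̄ = E_{a,b} h`, `C(c) = E_b[g(c,·)E_a h(c,·,·)] − G_C(c)H̄(c) = Cov_b(g_c, E_a h_c) ≥ 0`,
  where `E_3^γ` is Sahi's functional of the three PROJECTED functions on the block `γ` alone (`= M + fibreCov` of `…SahiResampledMargin` regrouped).
* **`sahiE_three_nonneg_T1_of_halfCov` (THE HALF-COVARIANCE FACE OF T₁).**  Let `γ = Cb × Ab × E` be itself a product of three blocks (FKG lattices `Cb, Ab`; `E` a two-point chain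
  `e₀ ≤ e₁` — one coin), `g` ignore the `Ab`-part of `γ` and `h` ignore the `Cb`-part (for cubes: the three events have EXACTLY ONE common essential coordinate `e`; `Cb` = the other
  coordinates shared by `f, g`; `Ab` = those shared by `f, h` and `f`'s private ones; `β` = the rest — the class `|T_3| = 1`, "T₁" of the seat memos).  Then the projected pair `(G_C, H̄)` shares
  only the chain `E`, so `E_3^γ(φ, G_C, H̄) ≥ 0` is THEOREM A of this lane (`SahiSharedTwoPoint.sahiE_three_nonneg_sharedTwoPoint`), and therefore
  **`E_3(f,g,h) ≥ 0` as soon as `(E_c φ)(E_c C) ≤ 2·E_c[φ·C]`** (the half-covariance condition at the member `f`).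
CENSUS (seat gen 24, exact identity check on 18 369 720 member-cells): on the exhaustive T₁ universe of the 4-cube (83 880 unordered triples × 73 bias vectors) the condition holds for SOME
member in 6 107 737 of 6 123 240 (triple, bias) pairs (99.75 %); 260 triples resist at some bias (e.g. the gated triangle `(x₀(x₁∨x₂), x₀(x₁∨x₃), x₀(x₂∨x₃))`).  HONEST LABEL: a face; Kahn's
Conjecture 5 for `|T_3| ≤ 1` and in general remain OPEN. [this work]
-/

noncomputable section

open scoped Classical

namespace Summit.CriticalPhenomena.PercolationContinuityZ3.Theorems

namespace SahiResampledMargin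

open Finset
open Literature.Combinatorics.Sahi2008
open SahiTriangleClassT (swap_bc pull)
open SahiSharedTwoPoint (Y FC HH GG GC Ybar Hbar EH EF Gbar)

/-! ### 1. Plumbing: cyclic symmetry of `E_3` -/

/-- `E_3(a,b,c) = E_3(b,c,a)`. [folklore] -/
theorem sahiE_three_perm {X : Type} [Fintype X] (μ : X → ℝ) (a b c : X → ℝ) :
    sahiE μ 3 ![a, b, c] = sahiE μ 3 ![b, c, a] := by
  rw [sahiE_three, sahiE_three]
  have h1 : b * c * a = a * b * c := by funext x; simp only [Pi.mul_apply]; ring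
  have h2 : c * a = a * c := by funext x; simp only [Pi.mul_apply]; ring
  have h3 : b * a = a * b := by funext x; simp only [Pi.mul_apply]; ring
  rw [h1, h2, h3]; ring

/-! ### 2. The block-averaging identity -/

section Averaging

variable {α β γ : Type} [Fintype α] [Fintype β] [Fintype γ]
  {wA : α → ℝ} {wB : β → ℝ} {wC : γ → ℝ} {f : γ → α → ℝ} {g : γ → β → ℝ} {h : γ → α → β → ℝ}

/-- **BLOCK-AVERAGING IDENTITY.**  For `f c a = φ c` (and `Σ wA = Σ wB = 1`):
`E_3(f,g,h) = E_3^γ(φ, G_C, H̄) + 2·E_c[φ·(K' − G_C H̄)] − (E_c φ)·E_c[K' − G_C H̄]`, `K'(c) = E_b[g·E_a h]`. [this work] -/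
theorem sahiE_three_eq_proj_add (φ : γ → ℝ) (hf : ∀ c a, f c a = φ c) (hA1 : ∑ a, wA a = 1) (hB1 : ∑ b, wB b = 1) :
    sahiE (fun q : α × β × γ => wA q.1 * wB q.2.1 * wC q.2.2) 3
        ![fun q => f q.2.2 q.1, fun q => g q.2.2 q.2.1, fun q => h q.2.2 q.1 q.2.1] =
      sahiE wC 3 ![φ, GC wB g, Hbar wA wB h] +
        (2 * (∑ c, wC c * (φ c * (KH wA wB g h c - GC wB g c * Hbar wA wB h c))) -
          (∑ c, wC c * φ c) * ∑ c, wC c * (KH wA wB g h c - GC wB g c * Hbar wA wB h c)) := by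
  have hY : ∀ c b, Y wA f h c b = φ c * HH wA h c b := by
    intro c b; unfold Y HH; rw [mul_sum]
    exact sum_congr rfl fun a _ => by rw [hf]; ring
  have hYb : ∀ c, Ybar wA wB f h c = φ c * Hbar wA wB h c := by
    intro c; unfold Ybar Hbar; rw [mul_sum]
    exact sum_congr rfl fun b _ => by rw [hY]; ring
  have hK : ∀ c, KK wA wB f g h c = φ c * KH wA wB g h c := by
    intro c; unfold KK KH; rw [mul_sum]
    exact sum_congr rfl fun b _ => by rw [hY]; ring
  rw [sahiE_three_eq_kplusMargin_add_fibreCov hA1 hB1, kplusMargin_eq_of_ignores φ hf hA1, sahiE_three, Gbar_eq_sum_GC]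
  unfold fibreCov
  simp only [hK, hYb, ex, Pi.mul_apply]
  unfold EH
  set Gs : ℝ := ∑ c, wC c * GC wB g c with hGs
  set Es : ℝ := ∑ c, wC c * Hbar wA wB h c with hEs
  have e1 : (∑ c, wC c * (φ c * ((GC wB g c - Gs) * (Hbar wA wB h c - Es)))) =
      (∑ c, wC c * (φ c * GC wB g c * Hbar wA wB h c)) - Es * (∑ c, wC c * (φ c * GC wB g c)) -
        Gs * (∑ c, wC c * (φ c * Hbar wA wB h c)) + (Gs * Es) * ∑ c, wC c * φ c := by
    rw [mul_sum, mul_sum, mul_sum, ← sum_sub_distrib, ← sum_sub_distrib, ← sum_add_distrib]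
    exact sum_congr rfl fun c _ => by ring
  have e2 : (∑ c, wC c * (φ c * KH wA wB g h c - GC wB g c * (φ c * Hbar wA wB h c))) =
      (∑ c, wC c * (φ c * KH wA wB g h c)) - ∑ c, wC c * (φ c * GC wB g c * Hbar wA wB h c) := by
    rw [← sum_sub_distrib]; exact sum_congr rfl fun c _ => by ring
  have e3 : (∑ c, wC c * (φ c * (KH wA wB g h c - GC wB g c * Hbar wA wB h c))) =
      (∑ c, wC c * (φ c * KH wA wB g h c)) - ∑ c, wC c * (φ c * GC wB g c * Hbar wA wB h c) := by
    rw [← sum_sub_distrib]; exact sum_congr rfl fun c _ => by ring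
  have e4 : (∑ c, wC c * (KH wA wB g h c - GC wB g c * Hbar wA wB h c)) =
      (∑ c, wC c * KH wA wB g h c) - ∑ c, wC c * (GC wB g c * Hbar wA wB h c) := by
    rw [← sum_sub_distrib]; exact sum_congr rfl fun c _ => by ring
  have e5 : (∑ x, wC x * (φ x * GC wB g x)) = ∑ c, wC c * (φ c * GC wB g c) := rfl
  rw [e1, e2, e3, e4]
  ring

omit [Fintype γ] in
/-- The fibre covariance `C(c) = K'(c) − G_C(c)H̄(c)` is nonnegative (FKG on `β`; `α` any block with a nonnegative weight). [this work] -/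
theorem KH_sub_nonneg [DistribLattice β] (hA0 : ∀ a, 0 ≤ wA a) (hB : IsFKGMeasure wB)
    (hg0 : ∀ c b, 0 ≤ g c b) (hgb : ∀ c, Monotone (g c)) (hh0 : ∀ c a b, 0 ≤ h c a b) (hhb : ∀ c a, Monotone (h c a)) (c : γ) :
    0 ≤ KH wA wB g h c - GC wB g c * Hbar wA wB h c := by
  unfold KH GC Hbar
  have hHH0 : ∀ b, 0 ≤ HH wA h c b := fun b => sum_nonneg fun a _ => mul_nonneg (hA0 a) (hh0 c a b)
  have hHHb : Monotone (HH wA h c) := fun b b' hbb => sum_le_sum fun a _ => mul_le_mul_of_nonneg_left (hhb c a hbb) (hA0 a)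
  exact sub_nonneg.mpr (SahiTriangleSupermodular.fkg_sum hB (hg0 c) hHH0 (hgb c) hHHb)

end Averaging

/-! ### 3. The half-covariance face of T₁ (`γ = Cb × Ab × E`, `g` ignores `Ab`, `h` ignores `Cb`) -/

section T1

variable {α β Cb Ab E : Type} [Fintype α] [Fintype β] [Fintype Cb] [Fintype Ab] [Fintype E]
  {wA : α → ℝ} {wB : β → ℝ} {wCb : Cb → ℝ} {wAb : Ab → ℝ} {wE : E → ℝ} {wC : Cb × Ab × E → ℝ}
  {f : Cb × Ab × E → α → ℝ} {g : Cb × Ab × E → β → ℝ} {h : Cb × Ab × E → α → β → ℝ}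

/-- **THEOREM (Kahn's `C_3` on the half-covariance face of `|T_3| ≤ 1`).**  Blocks: `α`, `β` (any finite types with probability weights; `f` ignores `α`; NO lattice hypothesis on `β` and no monotonicity in `b` are needed), and
`γ = Cb × Ab × E` with the product weight `wC = wCb ⊗ wAb ⊗ wE`, `Cb, Ab` FKG lattices and `E` a preorder whose weight sits on two comparable points;
`f c a = φ c` (monotone in `c`), `g c b = g' c.1 c.2.2 b` (ignores `Ab`), `h c a b = h' c.2.1 c.2.2 a b` (ignores `Cb`), all nonnegative and coordinatewise monotone.
If the half-covariance condition `(E_c φ)·E_c[C] ≤ 2·E_c[φ·C]` holds (`C = K' − G_C H̄`), then `E_3(f,g,h) ≥ 0`. [this work] -/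
theorem sahiE_three_nonneg_T1_of_halfCov [DistribLattice Cb] [DistribLattice Ab] [Preorder E]
    (hA0 : ∀ a, 0 ≤ wA a) (hA1 : ∑ a, wA a = 1) (hB0 : ∀ b, 0 ≤ wB b) (hB1 : ∑ b, wB b = 1) (hCb : IsFKGMeasure wCb) (hAb : IsFKGMeasure wAb)
    (hE0 : ∀ e, 0 ≤ wE e) (hE1 : ∑ e, wE e = 1) {e₀ e₁ : E} (h01 : e₀ ≤ e₁) (hsupp : ∀ e, e ≠ e₀ → e ≠ e₁ → wE e = 0)
    (hwC : wC = fun c => wCb c.1 * wAb c.2.1 * wE c.2.2)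
    (φ : Cb × Ab × E → ℝ) (hf : ∀ c a, f c a = φ c) (hφ0 : ∀ c, 0 ≤ φ c)
    (hφ1 : ∀ a e, Monotone (fun c' => φ (c', a, e))) (hφ2 : ∀ c' e, Monotone (fun a => φ (c', a, e))) (hφ3 : ∀ c' a, Monotone (fun e => φ (c', a, e)))
    (g' : Cb → E → β → ℝ) (hg : ∀ c b, g c b = g' c.1 c.2.2 b) (hg0 : ∀ c' e b, 0 ≤ g' c' e b)
    (hg1 : ∀ e b, Monotone (fun c' => g' c' e b)) (hg2 : ∀ c' b, Monotone (fun e => g' c' e b))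
    (h' : Ab → E → α → β → ℝ) (hh : ∀ c a b, h c a b = h' c.2.1 c.2.2 a b) (hh0 : ∀ a' e a b, 0 ≤ h' a' e a b)
    (hh1 : ∀ e a b, Monotone (fun a' => h' a' e a b)) (hh2 : ∀ a' a b, Monotone (fun e => h' a' e a b))
    (hcov : (∑ c, wC c * φ c) * (∑ c, wC c * (KH wA wB g h c - GC wB g c * Hbar wA wB h c)) ≤
      2 * ∑ c, wC c * (φ c * (KH wA wB g h c - GC wB g c * Hbar wA wB h c))) :
    0 ≤ sahiE (fun q : α × β × (Cb × Ab × E) => wA q.1 * wB q.2.1 * wC q.2.2) 3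
        ![fun q => f q.2.2 q.1, fun q => g q.2.2 q.2.1, fun q => h q.2.2 q.1 q.2.1] := by
  -- Theorem A for the projected triple (G_C, H̄, φ) on Cb × Ab × E
  have hA0' : 0 ≤ sahiE (fun q : Cb × Ab × E => wCb q.1 * wAb q.2.1 * wE q.2.2) 3
      ![fun q => (fun e c' => ∑ b, wB b * g' c' e b) q.2.2 q.1,
        fun q => (fun e a' => ∑ b, wB b * ∑ a, wA a * h' a' e a b) q.2.2 q.2.1,
        fun q => (fun e c' a' => φ (c', a', e)) q.2.2 q.1 q.2.1] := by
    refine SahiSharedTwoPoint.sahiE_three_nonneg_sharedTwoPoint (f := fun e c' => ∑ b, wB b * g' c' e b)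
      (g := fun e a' => ∑ b, wB b * ∑ a, wA a * h' a' e a b) (h := fun e c' a' => φ (c', a', e))
      hCb hAb hE0 hE1 h01 hsupp ?_ ?_ ?_ ?_ ?_ ?_ ?_ ?_ ?_ ?_
    · intro e c'; exact sum_nonneg fun b _ => mul_nonneg (hB0 b) (hg0 c' e b)
    · intro e c' c'' hcc; exact sum_le_sum fun b _ => mul_le_mul_of_nonneg_left (hg1 e b hcc) (hB0 b)
    · intro c' e e' hee; exact sum_le_sum fun b _ => mul_le_mul_of_nonneg_left (hg2 c' b hee) (hB0 b)
    · intro e a'; exact sum_nonneg fun b _ => mul_nonneg (hB0 b) (sum_nonneg fun a _ => mul_nonneg (hA0 a) (hh0 a' e a b))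
    · intro e a' a'' haa; exact sum_le_sum fun b _ => mul_le_mul_of_nonneg_left
        (sum_le_sum fun a _ => mul_le_mul_of_nonneg_left (hh1 e a b haa) (hA0 a)) (hB0 b)
    · intro a' e e' hee; exact sum_le_sum fun b _ => mul_le_mul_of_nonneg_left
        (sum_le_sum fun a _ => mul_le_mul_of_nonneg_left (hh2 a' a b hee) (hA0 a)) (hB0 b)
    · intro e c' a'; exact hφ0 _
    · intro c' a' e e' hee; exact hφ3 c' a' hee
    · intro e a' c' c'' hcc; exact hφ1 a' e hcc
    · intro e c' a' a'' haa; exact hφ2 c' e haa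
  -- identify the projected functions with G_C, H̄, φ
  have eG : GC wB g = fun q : Cb × Ab × E => ∑ b, wB b * g' q.1 q.2.2 b := by
    funext q; unfold GC; exact sum_congr rfl fun b _ => by rw [hg]
  have eH : Hbar wA wB h = fun q : Cb × Ab × E => ∑ b, wB b * ∑ a, wA a * h' q.2.1 q.2.2 a b := by
    funext q; unfold Hbar HH; exact sum_congr rfl fun b _ => by
      congr 1; exact sum_congr rfl fun a _ => by rw [hh]
  have hThmA : 0 ≤ sahiE wC 3 ![φ, GC wB g, Hbar wA wB h] := by
    rw [eG, eH, hwC, sahiE_three_perm]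
    exact hA0'
  have hC := sahiE_three_eq_proj_add (wA := wA) (wB := wB) (wC := wC) (f := f) (g := g) (h := h) φ hf hA1 hB1
  rw [hC]
  have hsc : 0 ≤ 2 * (∑ c, wC c * (φ c * (KH wA wB g h c - GC wB g c * Hbar wA wB h c))) -
      (∑ c, wC c * φ c) * ∑ c, wC c * (KH wA wB g h c - GC wB g c * Hbar wA wB h c) := by linarith
  exact add_nonneg hThmA hsc

end T1

end SahiResampledMargin

end Summit.CriticalPhenomena.PercolationContinuityZ3.Theorems
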